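import Summits.AtomisticToContinuum.Crystallization.Theorems.FrustratedLawDichotomyCellArithLipNash

/-!
# FrustratedLawDichotomy · crux `AperiodicFrustratedLawGap` (stmt-AtomisticToContinuum-27623) — CELL-ARITH «NASH-LIP», the Lipschitz brackets as
# EXACT RATIONAL functions (decomp-a2c hand-1 g53): so a K-file decides the slack `L i` of `…CellArithLipNash.norm_posL_le_of_centre_lip`

`ℚ` mirrors of `…CellArithLipNash.lipCoef/leadCoef` for rational windows and rational label/multiplier coordinates, with cast identities —
the brackets are small closed forms (inverse powers ≤ 9 of the class window endpoints, `ℓ¹` sums), evaluated once per (class, multiplier):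
* `psi1AbsQ lo hi` (= `Ψ₁`), `psi2AbsQ lo hi` (= `Ψ₂`), `lipCoefQ`, `leadCoefQ` + `lipCoef_cast`, `leadCoef_cast`;
* `slack_cast` — `Σ_{a∈s} lipCoef … = ((Σ_{a∈s} lipCoefQ …) : ℝ)` for Finset tables.
Computable `def`s over `ℚ`; imports `…CellArithLipNash`; 0 sorry.  Tags: [folklore].
-/

namespace Summit.AtomisticToContinuum.Crystallization.Theorems.FrustratedLawDichotomyCellArithLipQ

open scoped BigOperators
open Summit.AtomisticToContinuum.Crystallization.Theorems.FrustratedLawDichotomyCellArithLipNash (lipCoef leadCoef)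

/-- `Ψ₁(lo,hi) = max (−(−4lo⁻⁵ + 7hi⁻⁸)) (−4hi⁻⁵ + 7lo⁻⁸)` over `ℚ`. [folklore] -/
def psi1AbsQ (lo hi : ℚ) : ℚ := max (-(-4 * lo⁻¹ ^ 5 + 7 * hi⁻¹ ^ 8)) (-4 * hi⁻¹ ^ 5 + 7 * lo⁻¹ ^ 8)

/-- `Ψ₂(lo,hi) = max (−(20hi⁻⁶ − 56lo⁻⁹)) (20lo⁻⁶ − 56hi⁻⁹)` over `ℚ`. [folklore] -/
def psi2AbsQ (lo hi : ℚ) : ℚ := max (-(20 * hi⁻¹ ^ 6 - 56 * lo⁻¹ ^ 9)) (20 * lo⁻¹ ^ 6 - 56 * hi⁻¹ ^ 9)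

/-- the pair bracket over `ℚ` (mirror of `lipCoef`). [folklore] -/
def lipCoefQ (lo hi : ℚ) (z y : Fin 3 → ℚ) (i : Fin 3) : ℚ :=
  psi1AbsQ lo hi * (∑ j, |z j|) ^ 2 * |y i|
    + 2 * |z i| * ((∑ j, |z j|) * (∑ j, |y j|) * psi1AbsQ lo hi + |∑ j, z j * y j| * psi2AbsQ lo hi * (∑ j, |z j|) ^ 2)

/-- the lead bracket over `ℚ` (mirror of `leadCoef`). [folklore] -/
def leadCoefQ (lo hi : ℚ) (a : Fin 3 → ℚ) (i : Fin 3) : ℚ := psi1AbsQ lo hi * (∑ j, |a j|) ^ 2 * |a i|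

/-- cast of `Ψ₁`. -/
theorem psi1AbsQ_cast (lo hi : ℚ) :
    ((psi1AbsQ lo hi : ℚ) : ℝ) = max (-(-4 * (lo : ℝ)⁻¹ ^ 5 + 7 * (hi : ℝ)⁻¹ ^ 8)) (-4 * (hi : ℝ)⁻¹ ^ 5 + 7 * (lo : ℝ)⁻¹ ^ 8) := by
  unfold psi1AbsQ; push_cast; ring_nf

/-- cast of `Ψ₂`. -/
theorem psi2AbsQ_cast (lo hi : ℚ) :
    ((psi2AbsQ lo hi : ℚ) : ℝ) = max (-(20 * (hi : ℝ)⁻¹ ^ 6 - 56 * (lo : ℝ)⁻¹ ^ 9)) (20 * (lo : ℝ)⁻¹ ^ 6 - 56 * (hi : ℝ)⁻¹ ^ 9) := by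
  unfold psi2AbsQ; push_cast; ring_nf

/-- ★ `lipCoef` at rational data is the cast of `lipCoefQ`. [folklore] -/
theorem lipCoef_cast (lo hi : ℚ) (z y : Fin 3 → ℚ) (i : Fin 3) :
    lipCoef (lo : ℝ) (hi : ℝ) (fun j => (z j : ℝ)) (fun j => (y j : ℝ)) i = ((lipCoefQ lo hi z y i : ℚ) : ℝ) := by
  simp only [lipCoef, lipCoefQ, psi1AbsQ, psi2AbsQ]
  push_cast
  ring

/-- ★ `leadCoef` at rational data is the cast of `leadCoefQ`. [folklore] -/
theorem leadCoef_cast (lo hi : ℚ) (a : Fin 3 → ℚ) (i : Fin 3) :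
    leadCoef (lo : ℝ) (hi : ℝ) (fun j => (a j : ℝ)) i = ((leadCoefQ lo hi a i : ℚ) : ℝ) := by
  simp only [leadCoef, leadCoefQ, psi1AbsQ]
  push_cast
  ring

/-- a Finset table of brackets casts termwise. [folklore] -/
theorem slack_cast {α : Type*} (s : Finset α) (lo hi : α → ℚ) (z y : α → Fin 3 → ℚ) (i : Fin 3) :
    ∑ a ∈ s, lipCoef (lo a : ℝ) (hi a : ℝ) (fun j => (z a j : ℝ)) (fun j => (y a j : ℝ)) i
      = ((∑ a ∈ s, lipCoefQ (lo a) (hi a) (z a) (y a) i : ℚ) : ℝ) := by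
  push_cast
  exact Finset.sum_congr rfl fun a _ => lipCoef_cast (lo a) (hi a) (z a) (y a) i

end Summit.AtomisticToContinuum.Crystallization.Theorems.FrustratedLawDichotomyCellArithLipQ
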